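import Mathlib
import HarnessLib
import HarnessLib.Audit
import Summits.QuantumFields.Statement
import Summits.QuantumFields.YangMills.Theorems.WeakCouplingRates
import HarnessLib.Audit.Status.Attr

/-!
Route: SourcedPressureJensen

CLOSED (superseded) 2026-08-28T01:22:59Z by planner-ym-idea-3-g2-0 — reason: superseded:route-QuantumFields-ColdBoxAllGroups — superseded by route-QuantumFields-ColdBoxAllGroups — note: dead-target by events: the leaf WeakCouplingRates.XiPow is a tree theorem (xiPow_holds, CBAG); director-ym R380 (01:22:44Z); glue 23809 re-landed against rev 9 beforehand (tree hygiene ✓). Not refuted: JensenFloor 22518 / FloorOfLowerLaw 22519 / LowerLawTransfer 22520 proved and banked; KS1″ 24297 (. The file is kept as the record of this route; refuted decls are indexed as negative knowledge (`ledger negatives`).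

# Route SourcedPressureJensen — all-G lattice gap ≤ β^(−ε) by putting the correlator into the free
energy — sourced pressure with rate, read off by Jensen

RUNG LINE (D-0145 ideator seat ym-idea-3, technique card «positivity / convexity»). HONEST LABEL:
the registered rung R2ξ = leaf
`WeakCouplingRates.XiPowSU2` (SU(2)) is ALREADY CLOSED in the tree (`xiPowSU2_holds`); the content
of this line is the strictly stronger,
still OPEN all-G leaf `Summit.QuantumFields.YangMills.Theorems.WeakCouplingRates.XiPow` (every
torus-limit state of 4-d Wilson lattice
Yang–Mills with compact simple G at β ≥ β₀ has RP-spectral gap ≤ β^(−ε); an UPPER bound on the gap,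
NOT the Clay gap, NOT the summit). The
deciding theorem proves `XiPow` (Assembly, kernel-checked) and specialises by `xiPowSU2_of_xiPow`;
filed under R2ξ only because `XiPow` is not
yet a registered closer (asked «to director-ym»). bears_on: R2ξ′ (XiPow, all G). No summit is proved
by this line.
It suffices to show X = KS ∧ KJ (∧ the provable-now floor extraction S): KS (SOURCED PRESSURE
INCREMENT) the torus pressure of the Wilson
action perturbed by a small CENTRED two-plaquette source −h·Σ_x (βc(x) − β⟨c⟩)(βc(x + n e₀) − β⟨c⟩),
0 < h ≤ h₀, exceeds the unsourced one by at
most −h·σ·C(n)² + C β^(−κ) + M h² per site, uniformly for separations 1 ≤ n ≤ 2β^A and eventually in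
the torus size — an extensive, IR-safe
free-energy statement in the reach of Chatterjee's Laplace method WITH RATE; KJ (JENSEN FLOOR) log E
e^X ≥ E X on the torus turns KS (with
h = β^(−κ/2)) into the ONE-SIDED quantitative free-gluon law β²·Cov_{β,Λ}(c₀, c_{n e₀}) ≥ σ·C(n)² −
C′β^(−κ/2) — exactly the floor the tree's
kernel glue consumes. The state never appears: no DLR, no conditioning, no comparison of an
infinite-volume correlator with anything.
Lean: `Summit.QuantumFields.YangMills.Theses.SourcedPressureJensen.SourcedPressureIncrement ∧
Summit.QuantumFields.YangMills.Theses.SourcedPressureJensen.JensenFloor`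

## Assembly
Pointwise in (G, r): KS gives the sourced increment, KJ the one-sided law, S the one-scale power
floor at separation ⌈β^A′⌉, and the tree's
kernel glue `massGapPowerDecayOf_of_polySeparationFloor` (plane (1,2), `r.continuous`) gives
`MassGapPowerDecayOf 4 r.ρ (A′/2)`, i.e. the OPEN
all-G leaf `XiPow` with ε = A′/2 — that implication IS the Assembly item, PROVED sorry-free in the
seat's Sketch2.lean (`assembly_holds`, 8 lines:
`fun h1 h2 h3 => by intro G _ _ _ _ hG; letI : MeasurableSpace G := borel G; haveI : BorelSpace G :=
⟨rfl⟩; intro r; obtain ⟨A', κ', hA', hκ',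
hfloor⟩ := h3 G hG r (h2 G hG r (h1 G hG r)); exact ⟨A' / 2, by linarith,
massGapPowerDecayOf_of_polySeparationFloor r.ρ r.continuous (by decide)
(by decide) hA' hκ' hfloor⟩`). The deciding theorem `closes (hA : Assembly) (h1) (h2) (h3) :
XiPowSU2 := xiPowSU2_of_xiPow (hA h1 h2 h3)` consumes
every item (lean check rc 0, 0 sorries).

CLOSES_TARGET: closes rung R2xi of QuantumFields: Summit.QuantumFields.YangMills.Theorems.WeakCouplingRates.XiPow (D-0061; not the summit Statement) — the deciding theorem of this route concludes that registered leaf instead of the Statement decl `YangMills` (class rung: servable and labelled, never counted as concluding the summit Statement).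

Rationale: WHY THIS LINE. Convexity as the ENGINE: the only inequality between the measure and the target is
Jensen's, applied on the finite torus where the Gibbs
state is unique, so none of the usual obstructions (non-unique limit states, slow modes,
bulk-versus-box domination of a SIGNED connected
correlator — route WeakCouplingRates' `BulkDominatesColdBox`; block-boundary mismatch —
SteinGapBootstrap; exterior harmonic means —
EntropyBudgetEquipartition) is ever met by this route: they are all inside the tree's already-PROVED
kernel glue
`massGapPowerDecayOf_of_polySeparationFloor`, which passes from volume-uniform torus floors to
limit-state gap bounds. What is left is ONE
free-energy theorem with a source (KS): free energies are extensive and IR-safe — decoupling the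
torus into boxes of side β^(A′) ≫ n costs a
surface term (chessboard exponential moments of boundary energies, tree `abs_le_exp_of_chessboard`),
and inside a box Chatterjee's axial-gauge
Laplace analysis (arXiv:1602.01222; constant identified in arXiv:2511.07297) runs with an explicit
poly(box)/√β error, while the source — a
dimension-4 composite (curvature squared) two-point insertion — has an L-uniformly convergent
Gaussian cumulant expansion in h (connected
Wick cycles of |x|^(−4) curvature propagators have scaling dimension −4). The sign h > 0 is the
harmless one (e^(−hH) is bounded by a shift
β ↦ β(1 − 2h⟨βc⟩)); the line is one-sided BY NATURE and one-sided is all the leaf needs.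
Quantitative Griffiths/Guerra–Toninelli-type
"derivative of the pressure from its values + convexity" is the classical precedent
(doi:10.1007/s00220-002-0773-5); nothing of the kind
exists for lattice gauge theory at weak coupling. Versus the listed routes and tonight's siblings:
WeakCouplingRates (cold-box expansion of the
correlator, SU(2)), ColdBoxAllGroups (its all-G port), SteinGapBootstrap (Stein generator comparison
+ gap hypothesis), SoftLoopVariational
(variational trial vector in a cold box), EntropyBudgetEquipartition (my LINE 1: unsourced rate +
relative-entropy localisation),
EquipartitionCriticality (qualitative law): none puts the observable into the pressure.

RANKED CRUXES. #2 SourcedPressureIncrement (crux) — for every compact simple G and lattice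
representation r there are κ, A, σ, h₀ > 0 and M, C, β₀ with: for β ≥ β₀, 1 ≤ n ≤ 2β^A, 0 < h ≤ h₀,
eventually in L: |Λ_{L+1}|⁻¹·log E_{β,L+1} exp(−h·Σ_{x ∈ Λ} (βc(x) − β⟨c⟩)(βc(x + n e₀) − β⟨c⟩)) ≤
−h·σ·C(n)² + C·β^(−κ) + M·h² (c = (1,2)-plaquette cost N − Re tr r(U_p), ⟨c⟩ its torus mean, C(n) =
`curvaturePlaquetteCorr 4 n`). [difficulty: XL] (why it might fail: the increment must be resolved
to β^(−κ) ≪ h·β^(−8A) per site: box-decoupling surface terms C/box and the axial-gauge BCH error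
poly(box)/√β must both sit below it with box ≫ n (tiny A), and large fields must be priced uniformly
in the source h (centring adds +2h⟨βc⟩βS).) [arXiv:1602.01222, arXiv:2511.07297,
doi:10.1007/s00220-002-0773-5, arXiv:1803.01950]
#3 JensenFloor (crux) — at every (G, r): the sourced pressure increment bound (KS's body) implies
the one-sided law ∃ κ′, A, C′, σ > 0, β₁: for β ≥ β₁ and 1 ≤ n ≤ 2β^A, eventually in L, σ·C(n)² −
C′β^(−κ′) ≤ β²·(E_{β,L+1}[c₀ c_{n e₀}] − E[c₀]·E[c_{n e₀}]) — by Jensen log E e^X ≥ E X for the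
torus Wilson measure, torus translation invariance (E Σ_x g∘shift_x = |Λ|·E g) and the choice h =
β^(−κ/2). [deps: SourcedPressureIncrement] [difficulty: M] (why it might fail: routine
mathematically; formal risks: Jensen for `wilsonExpectation` as a Bochner integral on the torus
Wilson probability measure, integrability of the exponential observable, torus-translation
invariance of `wilsonExpectation ∘ toTorusObservable ∘ configShift` — none yet a named tree lemma.)
[doi:10.1007/s00220-002-0773-5,
friedli2017-statistical-mechanics-lattice-systems-concrete-mathematical-introduc]
#9 FloorOfLowerLaw (support) — at every (G, r): the one-sided law (JensenFloor's conclusion) implies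
∃ A′, κ″ > 0 with `PolySeparationPlaquetteFloor 4 r.ρ 1 2 A′ κ″` (real arithmetic with 8A′ < κ′ and
the PROVED lattice-Maxwell floor |C(n)| ≥ κ₀/n⁴, tree
`WeakCouplingRates.curvatureCorrPowerFloor_proof`, item 19457). [difficulty: provable-now]
[LawlerLimic2010, GarbanSepulveda2023]

TWO-LAYER PLAN. KS ⇐ KS1 → KS2 → KS with KS1 = BOX LAPLACE WITH SOURCE (axial gauge on a box of side
⌈β^(A′)⌉, A′ > 9A: sourced box free energy = Gaussian
sourced value ± poly(box)/√β, the Gaussian value's h-expansion having first coefficient σ·C(n)² up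
to the straddling fraction n/box and
|second coefficient| ≤ M uniformly in L) and KS2 = BOX-TO-TORUS (sub/super-additivity of the sourced
pressure with surface error C/box from
chessboard exponential moments of boundary energies, uniformly in 0 < h ≤ h₀); filed only after KS
moves.

KILL CRITERIA. A refutation of SourcedPressureIncrement — e.g. torus measures whose sourced pressure
increment at h = β^(−κ/2), n = ⌈β^A⌉ undershoots
−h·σ·C(n)² by more than every C β^(−κ) (a NON-universal additive correction to the
plaquette–plaquette covariance at polynomial separation) —
closes the route (`close --reason refuted:SourcedPressureIncrement`); by Jensen-tightness KS is
essentially EQUIVALENT to the one-sided law with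
rate, so the same numerics kill or confirm both. Mooted (not refuted) if ColdBoxAllGroups or
EntropyBudgetEquipartition reaches XiPow first.

NOT DECOMPOSED YET. KS1/KS2 above; the Gaussian cumulant bound (connected Wick cycles of curvature
propagators, scaling dimension −4, giving M); the large-field
pricing inside the Laplace step uniformly in the source; exponents (κ vs A: the line predicts any A
< κ/18 works).

CHEAPEST FALSIFIER. The same one-loop lattice perturbation theory check as for any free-gluon floor:
β²·Cov(c₀, c_n) = σ·C(n)²·(1 + c₁(n)/β + …) must have no
NON-universal additive correction ≥ β^(−κ) at polynomial n; in sourced form: the h-slope of the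
measured torus pressure increment at small h
equals the measured covariance (Jensen-tightness), so ONE Monte-Carlo free-energy-difference
measurement (reweighting in h at β = 2.5–2.7, SU(2),
16⁴, n = 2–4) against σ·C(n)²/β² tests KS directly. Instrument row: SU(2) plaquette–plaquette
correlators at β = 2.5–2.85, separations 1–6, vs
π²n⁴C(n) → 1 (item 19457). Not run by me (no kit in this seat).

NUMBERS. C(n) ≍ 1/(π² n⁴) (item 19457: π²n⁴C(n) = 1.092, 1.020, 1.005 at n = 8, 16, 32); budget
β·⟨c⟩ → dim G/4 (tree); the Jensen loss with h =
β^(−κ/2): floor σC(n)² − (C + M)β^(−κ/2), so the floor survives at n = β^A iff 8A < κ/2;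
WeakCouplingRates' SU(2) exponents (A, θ) ≈ (1/1000, 1/50)
show how small A may be taken.

DEFINITION REQUESTS. None: the sourced pressure is written with existing constants
(`wilsonExpectation`, `toTorusObservable`, `configShift`, `plaqCost0`, `timeShiftLG`,
`Real.exp`, a `Finset.univ` sum over `Fin 4 → Fin (L+1)`); lean check of Sketch2.lean rc 0.

Novelty: Searches (2026-08-27, corpus fts+vec AND galaxy): lit search "leading term Yang-Mills free energy
lattice gauge" --source all ([corpus:arxiv-1602.01222 p3],
[corpus:arxiv-2511.07297 p4 Thm 1: o(1), no rate, no source], [corpus:arxiv-2406.19321 p30]); lit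
search --hybrid "relative entropy Gibbs measure Gaussian
approximation lattice gauge theory weak coupling" and "specific relative entropy Pinsker …"
(textbooks only: [corpus:friedli2017], [corpus:albeverio2012 pp75-101],
[corpus:montvay1994 p141], [corpus:creutz2022 p58]); lit vsearch "<free energy of lattice YM
determines … Gaussian free field>" (none on point); lit search
"Stein's method lattice gauge theory Gaussian" --source all ([corpus:arxiv-2412.15422 p4], 2D); lit
galaxy search "relative entropy|lattice gauge", "entropy
method|Yang-Mills", "Stein's method|exchangeable pair", "lattice gauge|Yang-Mills free energy"
--star pdf (no gauge-theory hits); OpenAlex/S2 rate-limited (429);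
`lean search` / tree: no decl for a sourced Wilson pressure; negatives index (7 YM entries) has
nothing on free energies or sources.
Nearest prior art found: arXiv:1602.01222 / arXiv:2511.07297 (unsourced leading term + constant,
o(1)); Guerra–Toninelli doi:10.1007/s00220-002-0773-5
(pressure values + convexity ⇒ internal-energy/overlap control with rates, spin glasses); Griffiths'
lemma on derivatives of convex limits (friedli2017 ch. 3);
route WeakCouplingRates (SU(2) floor by cold boxes); sibling lines EntropyBudgetEquipartition /
SteinGapB  [refs: 10.1007/s00220-002-0773-5, 1602.01222, 2511.07297, arxiv-1602.01222, arxiv-2511.07297, arxiv-2406.19321, arxiv-2412.15422, doi:10.1007/s00220-002-0773-5]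

Barriers (technique_class: convexity, sourced-free-energy, jensen, laplace-asymptotics): - technique_class: convexity, sourced-free-energy, jensen, laplace-asymptotics
- Literature.Barriers.QuantumFields.PerturbativeInvisibility: does not bite — an UPPER bound on the
gap at power scale β^ε, read inside the perturbative window (n ≤ β^A ≪ ξ); no quantity flat in g is
claimed.
- Literature.Barriers.QuantumFields.StochasticQuantisationCriticality: outside its class — no
dynamics, no SPDE, no functional inequality for the YM measure; only Jensen on a finite torus.
- Literature.Barriers.QuantumFields.FixedCouplingUltralocality: does not apply — no scaling limit is
taken.
- Literature.Barriers.QuantumFields.UVStabilityNonUniqueness: not applicable.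
- Literature.Barriers.QuantumFields.NonabelianCoulombPhaseD5: does not quantify over this line — the
barrier (conditionally) blocks d-blind proofs of a lattice MASS GAP (uniform exponential clustering)
or of the AREA LAW for SU(2)₄ at all β; this line proves the OPPOSITE-direction statement, an UPPER
bound gap ≤ β^(−ε) at β ≫ 1, and its d = 5 transcript (sourced pressure + Jensen is indeed d-blind
for d ≥ 4, with C_d(n) ≍ n^(−d)) concludes gap ≤ β^(−ε) for SU(2)₅, which clause (2) of the
conjectured Coulomb phase IMPLIES rather than contradicts; no clustering, no confinement, no lower
bound on any mass is asserted anywhere in the route.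
- Literature.Barriers.QuantumFields.AbelianDeconfinementD4: same placement on the G-axis — the U(1)₄
transcript of the line (gap ≤ β^(−ε) in Guth's massless Coulomb phase) is TRUE, so group-bl

History (route lifecycle, newest last):
- 2026-08-27T21:16:39Z · closes_target -> closes rung R2xi-G of QuantumFields: Summit.QuantumFields.YangMills.Theorems.WeakCouplingRates.XiPow (D-0061; not the summit Statement) (planner-ym-idea-3-g0-0)
- 2026-08-27T21:59:26Z · closes_target -> closes rung R2xi of QuantumFields: Summit.QuantumFields.YangMills.Theorems.WeakCouplingRates.XiPow (D-0061; not the summit Statement) (planner-ym-idea-3-g0-0)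
- 2026-08-28T00:13:04Z · rev 6: restated ColdBoxSourcedPressure (stmt-QuantumFields-23807) — rebase (LINE 2 rev 2, seat ym-idea-3 g2): ColdBoxSourcedPressure restated from the PERIODIC cold box to the FREE-boundary cold cell (torus Wilson expectation re (planner-ym-idea-3-g2-0)
- 2026-08-28T00:16:35Z · rev 7: restated SourcedPressureDecoupling (stmt-QuantumFields-23808) — rebase (LINE 2 rev 2, seat ym-idea-3 g2), second half: SourcedPressureDecoupling restated from "torus ≤ periodic cold box" to the ENTROPIC-SEAM decoupling "toru (planner-ym-idea-3-g2-0)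
- 2026-08-28T01:02:22Z · rev 8: restated SourcedPressureDecoupling (stmt-QuantumFields-24028) — window (LINE 2 rev 3, seat ym-idea-3 g2; answers idea-crit-4 P1′/P3 of 2026-08-28T00:43:48Z): SourcedPressureDecoupling gains a scale ceiling `∃ θ₀ > 0, ∀ A < θ (planner-ym-idea-3-g2-0)
- 2026-08-28T01:03:14Z · rev 9: restated ColdBoxSourcedPressure (stmt-QuantumFields-23996) — window (LINE 2 rev 3, seat ym-idea-3 g2; answers idea-crit-4 P1′/P3 of 2026-08-28T00:43:48Z): SourcedPressureDecoupling gains a scale ceiling `∃ θ₀ > 0, ∀ A < θ (planner-ym-idea-3-g2-0)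
- 2026-08-28T01:22:59Z · CLOSED superseded — superseded:route-QuantumFields-ColdBoxAllGroups (planner-ym-idea-3-g2-0)

sub-problem: YangMills · status: closed(superseded) · opened planner-ym-idea-3-g0-0 2026-08-27T21:01:09Z · rev 9 · ledger route-QuantumFields-SourcedPressureJensen
GENERATED by the gate from the ledger (D-0016/17). Provers cite these decls: `theorem foo : Summit.QuantumFields.YangMills.Theses.SourcedPressureJensen.<Decl> := …` in Summits/QuantumFields/YangMills/Theorems/<Name>.lean.
-/

namespace Summit.QuantumFields.YangMills.Theses.SourcedPressureJensen

open scoped BigOperators Topology Manifold Classical MeasureTheory ProbabilityTheory Matrix InnerProductSpace ComplexConjugate ContinuousMap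
open Filter Set Function TopologicalSpace MeasureTheory

attribute [summit_statement] _root_.YangMills
attribute [summit_statement] _root_.Summit.QuantumFields.YangMills.Theorems.WeakCouplingRates.XiPow

/-- item stmt-QuantumFields-22517 · crux · rank 2 · closed · moot by None · by planner
why it might fail: Needs the sourced torus pressure to ABSOLUTE per-site precision β^-κ, κ > 16A, uniformly in L, for a quadratic non-local (range ≤ 2β^A) non-RP source: box decoupling with the source and h-uniform large-field pricing are unproved; wall = XiCompleteMonotonicity 8937/8938 (infinite-volume Gaussianity).
sources: arXiv:1602.01222, arXiv:1803.01950, stmt-QuantumFields-8937, stmt-QuantumFields-8938, Literature.Barriers.QuantumFields.PerturbativeInvisibility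
retired/moot children: ColdBoxSourcedPressure [replaced: open Literature.MathematicalPhysics.QuantumFieldTheory Literature.MathematicalPh]; SourcedPressureDecoupling [replaced: open Literature.MathematicalPhysics.QuantumFieldTheory Literature.MathematicalPh]; ColdBoxSourcedPressure [replaced: open Literature.MathematicalPhysics.QuantumFieldTheory Literature.MathematicalPh]; SourcedPressureDecoupling [replaced: open Literature.MathematicalPhysics.QuantumFieldTheory Literature.MathematicalPh]
[crux] for every compact simple G and lattice representation r there are κ, A, σ, h₀ > 0 and M, C,
β₀ with: for β ≥ β₀, 1 ≤ n ≤ 2β^A, 0 < h ≤ h₀, eventually in L: |Λ_{L+1}|⁻¹·log E_{β,L+1}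
exp(−h·Σ_{x ∈ Λ} (βc(x) − β⟨c⟩)(βc(x + n e₀) − β⟨c⟩)) ≤ −h·σ·C(n)² + C·β^(−κ) + M·h² (c =
(1,2)-plaquette cost N − Re tr r(U_p), ⟨c⟩ its torus mean, C(n) = `curvaturePlaquetteCorr 4 n`).
[difficulty: XL] -/
@[route_item "route-QuantumFields-SourcedPressureJensen", crux]
def SourcedPressureIncrement : Prop :=
  open Literature.MathematicalPhysics.QuantumFieldTheory Literature.MathematicalPhysics.QuantumLattice Summit.QuantumFields.YangMills.Theorems.WeakCouplingRates in ∀ (G : Type) [Group G] [TopologicalSpace G] [IsTopologicalGroup G] [CompactSpace G], IsCompactSimpleLieGroup G → letI : MeasurableSpace G := borel G; haveI : BorelSpace G := ⟨rfl⟩; ∀ r : LatticeRep G, ∃ κ A M C σ h₀ β₀ : ℝ, 0 < κ ∧ 0 < A ∧ 0 < σ ∧ 0 < h₀ ∧ ∀ β : ℝ, β₀ ≤ β → ∀ n : ℕ, 1 ≤ n → (n : ℝ) ≤ 2 * β ^ A → ∀ h : ℝ, 0 < h → h ≤ h₀ → ∀ᶠ L : ℕ in Filter.atTop, ((L + 1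 : ℝ) ^ 4)⁻¹ * Real.log (wilsonExpectation (L := L + 1) r.ρ β fun U => Real.exp (-h * ∑ x : Fin 4 → Fin (L + 1), toTorusObservable (L + 1) (fun V => (β * plaqCost0 (d := 4) r.ρ 1 2 (configShift (fun i => -((x i : ℕ) : ℤ)) V) - β * wilsonExpectation (L := L + 1) r.ρ β (toTorusObservable (L + 1) (plaqCost0 (d := 4) r.ρ 1 2))) * (β * plaqCost0 (d := 4) r.ρ 1 2 (timeShiftLG (G := G) n (configShift (fun i => -((x i : ℕ) : ℤ)) V)) - β * wilsonExpectation (L := L + 1) r.ρ β (toTorusObservable (L + 1) (plaqCost0 (d := 4) r.ρ 1 2)))) U)) ≤ -h * (σ * (curvaturePlaquetteCorr (d := 4) (by norm_num) (n : ℤ)) ^ 2) + C * β ^ (-κ) + M * h ^ 2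

-- parent: SourcedPressureIncrement · child (gen 1)
/--     item stmt-QuantumFields-24297 · crux · rank 201 · closed · moot by None
    parent: SourcedPressureIncrement · by planner
    why it might fail: Free b.c. adds zero modes and an O(1/ℓ) = O(β^−θ) boundary layer to the axial-gauge Laplace expansion, so κ ≤ θ ≤ θ₀ and the signal needs θ > 16A; the h-tilted susceptibility bound in a FREE cell is unproved for general compact simple G; mis-centring |m| ≤ W costs O(hW/ℓ) + M(W)h².
    sources: arXiv:1602.01222, stmt-QuantumFields-22893
[crux] KS1″ free-cell sourced Laplace BELOW ANY SCALE CEILING (rev 8): for every θ₀ > 0 there are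
regime exponents θ ≤ θ₀, 0 < A < θ, a rate κ > 0 and a Gaussian constant σ > 0 such that for every
centring window W (M, C, h₀, β₀ depending on W): for β ≥ β₀, |m| ≤ W, every cell side ℓ+1 ∈ [β^θ,
4β^θ], 1 ≤ n ≤ 2β^A, 0 < h ≤ h₀ and every ambient torus of side L+1 ≥ ℓ+2, the per-site increment
((ℓ+1)^4)⁻¹·log( E_T[exp(−h·Σ_{pairs inside [0,ℓ]^4}(βc_x − m)(βc_{x+ne₀} − m))·e^{β·S_out}] /
E_T[e^{β·S_out}] ) — the free-b.c. Wilson cell, value independent of L — is ≤ −hσ·C(n)² + Cβ^(−κ) +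
Mh² (objects exactly as in rev 7; only the leading quantifier `∀ θ₀ > 0, ∃ θ ≤ θ₀` is new: the cell
analysis is scale-covariant and smaller cells are colder, so the prover simply picks θ = min(θ₀, its
own), A = θ/32, κ ≤ θ). Needed because the decoupling half KS2″ is provable with present tools only
below a scale ceiling (Brascamp–Lieb window θ < 1/10). Plan unchanged: Chatterjee's free-b.c. cube
in axial gauge (arXiv:1602.01222 §3–4) + the tree's ExpChartPackage2 (stmt-QuantumFields-22893) with
the pair source at first/second order; boundary layer O(1/ℓ) per site forces κ ≤ θ and θ > 16A. -/
@[route_item "route-QuantumFields-SourcedPressureJensen"]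
def ColdBoxSourcedPressure : Prop :=
  open Literature.MathematicalPhysics.QuantumFieldTheory Literature.MathematicalPhysics.QuantumLattice Summit.QuantumFields.YangMills.Theorems.WeakCouplingRates in ∀ (G : Type) [Group G] [TopologicalSpace G] [IsTopologicalGroup G] [CompactSpace G], IsCompactSimpleLieGroup G → letI : MeasurableSpace G := borel G; haveI : BorelSpace G := ⟨rfl⟩; ∀ r : LatticeRep G, ∀ θ₀ : ℝ, 0 < θ₀ → ∃ θ κ A σ : ℝ, θ ≤ θ₀ ∧ 0 < A ∧ A < θ ∧ 0 < κ ∧ 0 < σ ∧ ∀ W : ℝ, ∃ M C h₀ β₀ : ℝ, 0 < h₀ ∧ ∀ β : ℝ, β₀ ≤ β → ∀ m : ℝ, |m| ≤ W → ∀ ℓ : ℕ, β ^ θ ≤ (ℓ + 1 : ℝ) → (ℓ + 1 : ℝ) ≤ 4 * β ^ θ → ∀ n : ℕ, 1 ≤ n → (n : ℝ) ≤ 2 * β ^ A → ∀ h : ℝ, 0 < h → h ≤ h₀ → ∀ L : ℕ, ℓ + 1 ≤ L → ((ℓ + 1 : ℝ) ^ 4)⁻¹ * Real.log (wilsonExpectation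 (L := L + 1) r.ρ β (fun U => Real.exp (-(h) * (∑ x : Fin 4 → Fin (L + 1), if ((∀ k : Fin 4, ((x k : ℕ)) ≤ ℓ) ∧ ((x 1 : ℕ)) + 1 ≤ ℓ ∧ ((x 2 : ℕ)) + 1 ≤ ℓ ∧ ((x 0 : ℕ)) + n ≤ ℓ) then toTorusObservable (L + 1) (fun V => (β * plaqCost0 (d := 4) r.ρ 1 2 (configShift (fun k => -((x k : ℕ) : ℤ)) V) - m) * (β * plaqCost0 (d := 4) r.ρ 1 2 (timeShiftLG (G := G) n (configShift (fun k => -((x k : ℕ) : ℤ)) V)) - m)) U else 0)) * Real.exp (β * (∑ x : Fin 4 → Fin (L + 1), ∑ i : Fin 4, ∑ j : Fin 4, if i < j ∧ ¬ ((∀ k : Fin 4, ((x k : ℕ)) ≤ ℓ) ∧ ((x i : ℕ)) + 1 ≤ ℓ ∧ ((x j : ℕ)) + 1 ≤ ℓ) then toTorusObservable (L + 1) (fun V => plaqCost0 (d := 4) r.ρ i j (configShift (fun k => -((x k : ℕ) : ℤ)) V)) U else 0))) / wilsonExpectation (L := L + 1) r.ρ β (fun U => Real.exp (β * (∑ x :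 Fin 4 → Fin (L + 1), ∑ i : Fin 4, ∑ j : Fin 4, if i < j ∧ ¬ ((∀ k : Fin 4, ((x k : ℕ)) ≤ ℓ) ∧ ((x i : ℕ)) + 1 ≤ ℓ ∧ ((x j : ℕ)) + 1 ≤ ℓ) then toTorusObservable (L + 1) (fun V => plaqCost0 (d := 4) r.ρ i j (configShift (fun k => -((x k : ℕ) : ℤ)) V)) U else 0)))) ≤ -(h) * (σ * (curvaturePlaquetteCorr (d := 4) (by norm_num) (n : ℤ)) ^ 2) + C * β ^ (-κ) + M * (h) ^ 2

-- parent: SourcedPressureIncrement · child (gen 1)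
/--     item stmt-QuantumFields-24296 · crux · rank 202 · closed · moot by None
    parent: SourcedPressureIncrement · by planner
    why it might fail: Brascamp–Lieb needs uniform log-concavity of the small-field Wilson action in complete axial gauge on cells of side 4β^θ (θ ≤ θ₀ ≈ 1/16) plus a union-bound large-field tail P(c_p > β^(−1/2+δ)) ≤ e^(−cβ^δ) in FREE cells; exp-chart corrections to loop variances must stay O(1/β) per link.
    sources: Georgii2011, arXiv:1602.01222, BrascampLieb1976
[crux] KS2″ ENTROPIC-SEAM DECOUPLING with a SCALE CEILING (rev 8; answers idea-crit-4's P1′/P3 of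
2026-08-28T00:43:48Z): there is θ₀ > 0 (the line's value: θ₀ = 1/16) such that for all A < θ ≤ θ₀
there are W, κ′ > 0, h₁ > 0, C′, M′, β₂ with: for β ≥ β₂, 1 ≤ n ≤ 2β^A, 0 < h ≤ h₁ some cell side
ℓ+1 ∈ [β^θ, 4β^θ] with, eventually in L: |m_T| ≤ W and INCR_T(h) ≤ ½·FREE_ℓ(2h; m_T) + C′β^(−κ′) +
M′h² (objects exactly as in rev 7). Mechanism (1) translation-averaged Jensen and (2) free-cell ⊗
Haar reference ν₀ as in rev 7; (3) the SEAM ENTROPY is counted WITHOUT a uniform smooth gauge: E_T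
e^{+βS_seam} = 1/E_{ν₀} e^{−W}; restricted Jensen −log E_{ν₀} e^{−W} ≤ −log ν₀(E) + E_{ν₀}[W | E] on
the event E = {both adjacent cells small-field (every plaquette cost ≤ β^(−1/2+δ): union bound over
≤ 256β^(4θ) plaquettes of a FREE cell) and every crossing link in the Haar ball of radius β^(−1/2)
about g₁(x)⁻¹g₂(x)}, g_i = complete axial gauge of cell i: −log ν₀(E) = #crossings·(dim G/2)·log β +
O(#crossings), and E[W | E] ≤ C·#seam plaquettes from an L²-SMOOTHNESS bound E Σ_{face links} |V^g −
1|² ≤ C·#links/β, obtained by BRASCAMP–LIEB in complete axial gauge — on the small-field event the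
Wilson ac -/
@[route_item "route-QuantumFields-SourcedPressureJensen"]
def SourcedPressureDecoupling : Prop :=
  open Literature.MathematicalPhysics.QuantumFieldTheory Literature.MathematicalPhysics.QuantumLattice Summit.QuantumFields.YangMills.Theorems.WeakCouplingRates in ∀ (G : Type) [Group G] [TopologicalSpace G] [IsTopologicalGroup G] [CompactSpace G], IsCompactSimpleLieGroup G → letI : MeasurableSpace G := borel G; haveI : BorelSpace G := ⟨rfl⟩; ∀ r : LatticeRep G, ∃ θ₀ : ℝ, 0 < θ₀ ∧ ∀ θ A : ℝ, 0 < A → A < θ → θ ≤ θ₀ → ∃ W κ' C' M' h₁ β₂ : ℝ, 0 < κ' ∧ 0 < h₁ ∧ ∀ β : ℝ, β₂ ≤ β → ∀ n : ℕ, 1 ≤ n → (n : ℝ) ≤ 2 * β ^ A → ∀ h : ℝ, 0 < h → h ≤ h₁ → ∃ ℓ : ℕ, β ^ θ ≤ (ℓ + 1 : ℝ) ∧ (ℓ + 1 : ℝ) ≤ 4 * β ^ θ ∧ ∀ᶠ L : ℕ in Filter.atTop, |β * wilsonExpectation (L := L + 1) r.ρ β (toTorusObservable (L + 1) (plaqCost0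 (d := 4) r.ρ 1 2))| ≤ W ∧ ((L + 1 : ℝ) ^ 4)⁻¹ * Real.log (wilsonExpectation (L := L + 1) r.ρ β fun U => Real.exp (-h * ∑ x : Fin 4 → Fin (L + 1), toTorusObservable (L + 1) (fun V => (β * plaqCost0 (d := 4) r.ρ 1 2 (configShift (fun i => -((x i : ℕ) : ℤ)) V) - β * wilsonExpectation (L := L + 1) r.ρ β (toTorusObservable (L + 1) (plaqCost0 (d := 4) r.ρ 1 2))) * (β * plaqCost0 (d := 4) r.ρ 1 2 (timeShiftLG (G := G) n (configShift (fun i => -((x i : ℕ) : ℤ)) V)) - β * wilsonExpectation (L := L + 1) r.ρ β (toTorusObservable (L + 1) (plaqCost0 (d := 4) r.ρ 1 2)))) U)) ≤ (1 / 2 : ℝ) * (((ℓ + 1 : ℝ) ^ 4)⁻¹ * Real.log (wilsonExpectation (L := L + 1) r.ρ β (fun U => Real.exp (-(2 * h) * (∑ x : Fin 4 → Fin (L + 1), if ((∀ k : Fin 4, ((x k : ℕ)) ≤ ℓ) ∧ ((x 1 : ℕ)) + 1 ≤ ℓ ∧ ((x 2 : ℕ)) + 1 ≤ ℓ ∧ ((x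 0 : ℕ)) + n ≤ ℓ) then toTorusObservable (L + 1) (fun V => (β * plaqCost0 (d := 4) r.ρ 1 2 (configShift (fun k => -((x k : ℕ) : ℤ)) V) - (β * wilsonExpectation (L := L + 1) r.ρ β (toTorusObservable (L + 1) (plaqCost0 (d := 4) r.ρ 1 2)))) * (β * plaqCost0 (d := 4) r.ρ 1 2 (timeShiftLG (G := G) n (configShift (fun k => -((x k : ℕ) : ℤ)) V)) - (β * wilsonExpectation (L := L + 1) r.ρ β (toTorusObservable (L + 1) (plaqCost0 (d := 4) r.ρ 1 2))))) U else 0)) * Real.exp (β * (∑ x : Fin 4 → Fin (L + 1), ∑ i : Fin 4, ∑ j : Fin 4, if i < j ∧ ¬ ((∀ k : Fin 4, ((x k : ℕ)) ≤ ℓ) ∧ ((x i : ℕ)) + 1 ≤ ℓ ∧ ((x j : ℕ)) + 1 ≤ ℓ) then toTorusObservable (L + 1) (fun V => plaqCost0 (d := 4) r.ρ i j (configShift (fun k => -((x k : ℕ) : ℤ)) V)) U else 0))) / wilsonExpectation (L := L + 1) r.ρ β (fun U => Real.exp (β * (∑ x : Fin 4 → Fin (L + 1), ∑ i : Fin 4,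 ∑ j : Fin 4, if i < j ∧ ¬ ((∀ k : Fin 4, ((x k : ℕ)) ≤ ℓ) ∧ ((x i : ℕ)) + 1 ≤ ℓ ∧ ((x j : ℕ)) + 1 ≤ ℓ) then toTorusObservable (L + 1) (fun V => plaqCost0 (d := 4) r.ρ i j (configShift (fun k => -((x k : ℕ) : ℤ)) V)) U else 0))))) + C' * β ^ (-κ') + M' * h ^ 2

-- parent: SourcedPressureIncrement · glue (gen 1)
/--     item stmt-QuantumFields-23809 · support · rank 203 · closed · proved by Summit.QuantumFields.YangMills.Theorems.SourcedPressureJensen.sourcedPressureIncrementGlue_proof (prover)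
    parent: SourcedPressureIncrement · GLUE: children ⟹ parent · by planner
KS1 → KS2 → KS: take KS's constants κ″ = min κ κ′, A, M+M′, |C|+|C′|, σ, min h₀ h₁, max β₀ β₁ 1; KS2
at the (θ, A) of KS1 gives the comparison box N and the eventually-in-L inequality, KS1 at N the box
bound; chain and weaken β^(−κ), β^(−κ′) ≤ β^(−κ″) for β ≥ 1. Kernel-checked by the seat
(line2/Sketch2.lean, theorem split_glue, rc 0, no sorry; attached as evidence) — provable now. -/
@[route_item "route-QuantumFields-SourcedPressureJensen"]
def SourcedPressureIncrementGlue : Prop :=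
  ColdBoxSourcedPressure → SourcedPressureDecoupling → SourcedPressureIncrement

-- `SourcedPressureIncrementGlue` holds: proved by `Summit.QuantumFields.YangMills.Theorems.SourcedPressureJensen.sourcedPressureIncrementGlue_proof` (its module imports this route file, so no `_holds` link can be stated here).

/-- item stmt-QuantumFields-22518 · crux · rank 3 · closed · proved by Summit.QuantumFields.YangMills.Cruxes.JensenFloor.Birth.JensenFloor_of (prover) · by planner
why it might fail: Mathematically safe (Jensen + torus translation invariance); Lean risks only: wilsonExpectation is a Bochner integral with junk value 0, so integrability of H and exp(-hH) (bounded continuous, r.ρ continuous) must be discharged; h = β^(-κ/2) gives κ' = κ/2, so FloorOfLowerLaw needs 16A < κ from KS.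
sources: arXiv:1602.01222, Literature.MathematicalPhysics.QuantumFieldTheory.toTorusObservable_comp_configShift, Literature.MathematicalPhysics.QuantumFieldTheory.wilsonExpectation_comp_torusConfigShift
[crux] at every (G, r): the sourced pressure increment bound (KS's body) implies the one-sided law ∃
κ′, A, C′, σ > 0, β₁: for β ≥ β₁ and 1 ≤ n ≤ 2β^A, eventually in L, σ·C(n)² − C′β^(−κ′) ≤
β²·(E_{β,L+1}[c₀ c_{n e₀}] − E[c₀]·E[c_{n e₀}]) — by Jensen log E e^X ≥ E X for the torus Wilson
measure, torus translation invariance (E Σ_x g∘shift_x = |Λ|·E g) and the choice h = β^(−κ/2).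
[deps: SourcedPressureIncrement] [difficulty: M] -/
@[route_item "route-QuantumFields-SourcedPressureJensen", crux]
def JensenFloor : Prop :=
  open Literature.MathematicalPhysics.QuantumFieldTheory Literature.MathematicalPhysics.QuantumLattice Summit.QuantumFields.YangMills.Theorems.WeakCouplingRates in ∀ (G : Type) [Group G] [TopologicalSpace G] [IsTopologicalGroup G] [CompactSpace G], IsCompactSimpleLieGroup G → letI : MeasurableSpace G := borel G; haveI : BorelSpace G := ⟨rfl⟩; ∀ r : LatticeRep G, (∃ κ A M C σ h₀ β₀ : ℝ, 0 < κ ∧ 0 < A ∧ 0 < σ ∧ 0 < h₀ ∧ ∀ β : ℝ, β₀ ≤ β → ∀ n : ℕ, 1 ≤ n → (n : ℝ) ≤ 2 * β ^ A → ∀ h : ℝ, 0 < h → h ≤ h₀ → ∀ᶠ L : ℕ in Filter.atTop, ((L + 1 : ℝ) ^ 4)⁻¹ * Real.log (wilsonExpectation (L := L + 1) r.ρ β fun U => Real.exp (-h * ∑ x : Fin 4 → Fin (L + 1), toTorusObservable (L + 1) (fun V => (β * plaqCost0 (d := 4) r.ρ 1 2 (configShift (fun i => -((x i : ℕ) : ℤ))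 V) - β * wilsonExpectation (L := L + 1) r.ρ β (toTorusObservable (L + 1) (plaqCost0 (d := 4) r.ρ 1 2))) * (β * plaqCost0 (d := 4) r.ρ 1 2 (timeShiftLG (G := G) n (configShift (fun i => -((x i : ℕ) : ℤ)) V)) - β * wilsonExpectation (L := L + 1) r.ρ β (toTorusObservable (L + 1) (plaqCost0 (d := 4) r.ρ 1 2)))) U)) ≤ -h * (σ * (curvaturePlaquetteCorr (d := 4) (by norm_num) (n : ℤ)) ^ 2) + C * β ^ (-κ) + M * h ^ 2) → ∃ κ' A C' σ β₁ : ℝ, 0 < κ' ∧ 0 < A ∧ 0 < σ ∧ ∀ β : ℝ, β₁ ≤ β → ∀ n : ℕ, 1 ≤ n → (n : ℝ) ≤ 2 * β ^ A → ∀ᶠ L : ℕ in Filter.atTop, σ * (curvaturePlaquetteCorr (d := 4) (by norm_num) (n : ℤ)) ^ 2 - C' * β ^ (-κ') ≤ β ^ 2 * (wilsonExpectation (L := L + 1) r.ρ β (toTorusObservable (L + 1) fun U => plaqCost0 (d := 4) r.ρ 1 2 U * plaqCost0 (d := 4) r.ρ 1 2 (timeShiftLG (G := G) n U)) - wilsonExpectation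 (L := L + 1) r.ρ β (toTorusObservable (L + 1) (plaqCost0 (d := 4) r.ρ 1 2)) * wilsonExpectation (L := L + 1) r.ρ β (toTorusObservable (L + 1) fun U => plaqCost0 (d := 4) r.ρ 1 2 (timeShiftLG (G := G) n U)))

-- `JensenFloor` holds: proved by `Summit.QuantumFields.YangMills.Cruxes.JensenFloor.Birth.JensenFloor_of` (its module imports this route file, so no `_holds` link can be stated here).

/-- item stmt-QuantumFields-22519 · support · rank 9 · closed · proved by Summit.QuantumFields.YangMills.Theorems.SourcedPressureJensen.floorOfLowerLaw_proof (prover) · by planner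
sources: LawlerLimic2010, GarbanSepulveda2023
[support] at every (G, r): the one-sided law (JensenFloor's conclusion) implies ∃ A′, κ″ > 0 with
`PolySeparationPlaquetteFloor 4 r.ρ 1 2 A′ κ″` (real arithmetic with 8A′ < κ′ and the PROVED
lattice-Maxwell floor |C(n)| ≥ κ₀/n⁴, tree `WeakCouplingRates.curvatureCorrPowerFloor_proof`, item
19457). [difficulty: provable-now] -/
@[route_item "route-QuantumFields-SourcedPressureJensen", crux]
def FloorOfLowerLaw : Prop :=
  open Literature.MathematicalPhysics.QuantumFieldTheory Literature.MathematicalPhysics.QuantumLattice Summit.QuantumFields.YangMills.Theorems.WeakCouplingRates in ∀ (G : Type) [Group G] [TopologicalSpace G] [IsTopologicalGroup G] [CompactSpace G], IsCompactSimpleLieGroup G → letI : MeasurableSpace G := borel G; haveI : BorelSpace G := ⟨rfl⟩; ∀ r : LatticeRep G, (∃ κ' A C' σ β₁ : ℝ, 0 < κ' ∧ 0 < A ∧ 0 < σ ∧ ∀ β : ℝ, β₁ ≤ β → ∀ n : ℕ, 1 ≤ n → (n : ℝ) ≤ 2 * β ^ A → ∀ᶠ L : ℕ in Filter.atTop, σ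 * (curvaturePlaquetteCorr (d := 4) (by norm_num) (n : ℤ)) ^ 2 - C' * β ^ (-κ') ≤ β ^ 2 * (wilsonExpectation (L := L + 1) r.ρ β (toTorusObservable (L + 1) fun U => plaqCost0 (d := 4) r.ρ 1 2 U * plaqCost0 (d := 4) r.ρ 1 2 (timeShiftLG (G := G) n U)) - wilsonExpectation (L := L + 1) r.ρ β (toTorusObservable (L + 1) (plaqCost0 (d := 4) r.ρ 1 2)) * wilsonExpectation (L := L + 1) r.ρ β (toTorusObservable (L + 1) fun U => plaqCost0 (d := 4) r.ρ 1 2 (timeShiftLG (G := G) n U)))) → ∃ A' κ' : ℝ, 0 < A' ∧ 0 < κ' ∧ PolySeparationPlaquetteFloor 4 r.ρ 1 2 A' κ'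

-- `FloorOfLowerLaw` holds: proved by `Summit.QuantumFields.YangMills.Theorems.SourcedPressureJensen.floorOfLowerLaw_proof` (its module imports this route file, so no `_holds` link can be stated here).

/-- item stmt-QuantumFields-22520 · crux (kind.auto-crux: conjecture-grade) · rank 1 · closed · proved by Summit.QuantumFields.YangMills.Theorems.SourcedPressureJensen.assembly_proof (prover) · by planner
why it might fail: auto-crux — conjecture-grade statement (statement references the registered conjecture Summit.QuantumFields.YangMills.Theorems.WeakCouplingRates.XiPow); it is open, so it may simply be false
sources: arXiv:1803.01950, OsterwalderSeiler1978
[assembly] SourcedPressureIncrement → JensenFloor → FloorOfLowerLaw → XiPow (the OPEN all-G rates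
leaf; provable now, script above). -/
@[route_item "route-QuantumFields-SourcedPressureJensen", crux]
def Assembly : Prop :=
  Summit.QuantumFields.YangMills.Theses.SourcedPressureJensen.SourcedPressureIncrement → Summit.QuantumFields.YangMills.Theses.SourcedPressureJensen.JensenFloor → Summit.QuantumFields.YangMills.Theses.SourcedPressureJensen.FloorOfLowerLaw → Summit.QuantumFields.YangMills.Theorems.WeakCouplingRates.XiPow

-- `Assembly` holds: proved by `Summit.QuantumFields.YangMills.Theorems.SourcedPressureJensen.assembly_proof` (its module imports this route file, so no `_holds` link can be stated here).

/-! D-0027 §2.1 — DECIDING THEOREM (planner-authored via `route open/edit --closes-file`; by planner-ym-idea-3-g0-0 2026-08-27T21:59:26Z) — ARCHIVED: route closed (superseded) 2026-08-28T01:22:59Z; kept so importers keep building: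
its hypotheses are this route's items and its conclusion the registered leaf `Summit.QuantumFields.YangMills.Theorems.WeakCouplingRates.XiPow` (rung R2xi, D-0061) (glue_lint), and it elaborates with this file. -/

@[closes "route-QuantumFields-SourcedPressureJensen"] theorem closes (hA : Assembly) (h1 : SourcedPressureIncrement) (h2 : JensenFloor) (h3 : FloorOfLowerLaw) :
    Summit.QuantumFields.YangMills.Theorems.WeakCouplingRates.XiPow :=
  hA h1 h2 h3

end Summit.QuantumFields.YangMills.Theses.SourcedPressureJensen
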